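import Literature.Analysis.FluidPDE.OseenMildUniqueness
import Literature.Analysis.FluidPDE.OseenKernelSemigroup
import HarnessLib

/-!
# KNSS 2009, Prop. 4.1 (smoothing of bounded mild solutions): reduction to the local theory

Analysis/FluidPDE decomposition-and-assembly file for the named fact **(P)**
`Literature.Analysis.FluidPDE.knss2009_smoothing` (`NSBoundedMildOseen.lean`;
Koch–Nadirashvili–Seregin–Šverák, Acta Math. 203 (2009) = arXiv:0709.3599, Prop. 4.1): a
bounded solution `u` of the Oseen integral equation `u(t) = e^{ν(t-s)Δ}a - B^ν_s(u,u)(t)` on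
`(s, T₁)` from `a ∈ L^∞` is represented by the jointly smooth field
`w(t) = e^{ν(t-s)Δ}a - B^ν_s(u,u)(t)`, bounded by `‖a‖_∞ ∨ ‖u‖_∞ ≤ M`, with
`(t-s)^{k/2+l}∇ᵏₓ∂ₜˡw` bounded on `(s, T₁) × E` for all `k, l`.

The printed proof (KNSS §4 p. 8) has three ingredients: (i) the **local theory** — (4.3)
`u = U + B(u,u)` is solved by a fixed point in `L^∞_{x,t}` on `(0, ε‖u₀‖^{-2}_∞)` thanks to
(4.4) `‖B(u,v)‖ ≤ C√T‖u‖‖v‖`, and the solution so built satisfies the smoothing estimates (4.5)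
`‖t^{k/2+l}∇ᵏₓ∂ₜˡu‖_{L^∞(ℝⁿ×(0,T'))} ≤ C(k,l)‖u₀‖_∞`, `T' = ε(k,l)‖u₀‖⁻²` ("This can be
proved in the same way as … [GigaSawada], [DongDu], [GermainPavlovicStaffilani] … The key is an
estimate of `B` … in spaces with norms given by the left-hand side of (4.5)"; Lemarié-Rieusset
2016, Thm. 9.12, pp. 260–263, proves the joint analyticity of bounded mild solutions by the same
local construction, after Cannon–Knightly); (ii) **uniqueness** of bounded solutions of the
integral equation, which identifies the local solution with the given one; (iii) **restart**
("(4.3) can be treated as an ODE in `t`") to cover `(s, T₁)` by windows of fixed length. This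
file vendors (i) as the named fact `knss2009_local_smoothing` (KNSS Prop. 4.1 in its
quantitative short-time form, together with the existence of the smooth local solution), takes
(iii) in the form of the sibling named fact (R) `oseenMild_restart` (`NSBoundedMildOseen.lean`),
and **proves** everything else:

* `oseenDuhamel_translate` (time translation of `B^ν_s`), `restart_of_oseenMild_restart`
  ((R) transported to an arbitrary initial time `s` with the datum `a` at the initial slice);
* `continuous_integral_oseenKernel_of_bound`, `continuous_oseenDuhamel_slice`: the slices of the
  Oseen operator and of the Duhamel term of bounded measurable fields are continuous (dominated
  convergence under Koch–Tataru's kernel bound (14) and `continuous_oseenKernel`);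
  `norm_le_of_continuous_of_ae_eq` (an essential bound is a pointwise bound for a continuous
  representative);
* `exists_local_smooth_representative`: by uniqueness (`oseenMild_essBounded_unique`,
  `OseenMildUniqueness.lean`) the local solution of (L) from the datum of a bounded solution
  agrees with it a.e. slice-wise, and the representative `e^{ν(t-s')Δ}a' - B^ν_{s'}(u,u)(t)`
  *is* the local solution, pointwise;
* `knss2009_smoothing_of_local : oseenMild_restart E → knss2009_local_smoothing E →
  knss2009_smoothing E` — the covering argument: `w = v` on `(s, s+h)`, `h = εν/(M+1)²`, and
  `w = v'` on every window `(s', s'+h)`, `s' = t - h/2`, restarted from the continuous bounded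
  datum `w(s')` (continuous slices a.e. equal coincide); hence `w` is jointly `C^n` near every
  point for every `n`, `‖w‖ ≤ M`, and the weighted bounds are sharp near `s` and constant on
  `[s+h, T₁)`.

## What remains: the plan for (L)

(L) is a theory of its own (the unit's notes, SIZE XL). It will be discharged along
Lemarié-Rieusset's proof of Thm. 9.12 (pp. 260–263): complexify time and space, show that the
Picard iterates of `v = e^{ν(τ-s)Δ}a - B^ν_s(v,v)` are holomorphic and bounded on the parabolic
cone `s + Ω_γ = {0 < Re(τ-s), |Im τ| < γ Re(τ-s), |Im z| < γ(ν|τ-s|)^{1/2}}` (the complexified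
Gaussian and Oseen kernels obey the real bounds up to `e^{Cγ²}`), converge locally uniformly for
`Re(τ-s) < εν/M²`, so that the limit is holomorphic (the tree's several-complex-variables
toolkit `Literature/Analysis/Complex/{SeveralVariables, OsgoodProofs, LocallyUniformLimitSCV}`:
holomorphic ⇒ `C^∞`, Cauchy estimates for iterated derivatives, locally uniform limits), and read
the parabolic weights `(ν(t-s))^{k/2}(t-s)^l` off anisotropic Cauchy estimates (polyradii
`γ(t-s)` in time, `γ(ν(t-s))^{1/2}` in space); only first complex derivatives and sup bounds
are needed, no all-orders real-variable kernel calculus.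

## Mathlib / tree search

Tree (`lean search 'oseenDuhamel|oseenMild|knss2009'`): `oseenDuhamel`, (R) `oseenMild_restart`,
(P) `knss2009_smoothing` (`NSBoundedMildOseen.lean`); `oseenDuhamel_congr_ae_slice`,
`integrable_oseenKernel_duhamel_bounded` (`NSBoundedMildOseenDuhamel.lean`);
`oseenMild_essBounded_unique` (`OseenMildUniqueness.lean`); `continuous_oseenKernel`
(`OseenKernelSemigroup.lean`); `heatExtension_congr_ae` (`MildL3Smooth.lean`);
`continuous_radialRetract`, `radialRetract_eq_self` (`BoundedRepresentative.lean`);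
`measurePreserving_timeShift_restrict` (`LerayHopfRestart.lean`);
`UnboundedOperators.contDiff_heatExtension_holds`. Mathlib: `continuousAt_of_dominated`,
`continuous_of_dominated`, `Continuous.ae_eq_iff_eq`, `contDiffOn_of_locally_contDiffOn`,
`contDiffOn_infty`, `Filter.EventuallyEq.iteratedDeriv_eq`, `ContinuousOn.aestronglyMeasurable`,
`MeasurePreserving.setIntegral_preimage_emb`.

## References

* G. Koch, N. Nadirashvili, G. Seregin, V. Šverák, *Liouville theorems for the Navier–Stokes
  equations and applications*, Acta Math. 203 (2009) 83–105 = arXiv:0709.3599 (arXiv page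
  numbers), §4 p. 8: (4.3)–(4.5), Prop. 4.1 and the paragraph following it, Rem. 4.2.
  [KochNadirashviliSereginSverak2009]
* P. G. Lemarié-Rieusset, *The Navier–Stokes problem in the 21st century*, CRC Press 2016
  (held, doi:10.1201/b19556), §9.9, Thm. 9.12 and its proof, pp. 260–263 (Cannon–Knightly's proof
  of time–space analyticity of bounded mild solutions through the Oseen series (9.38) on the
  cone `t₀ + Ω_{γ,M}`). [LemarieRieusset2016]
* Y. Giga, K. Inui, S. Matsui, *On the Cauchy problem for the Navier–Stokes equations with
  nondecaying initial data*, Quaderni di Matematica 4 (1999) 27–68 (local existence and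
  uniqueness for `u₀ ∈ L^∞`; KNSS's reference [Giga]).
* J. R. Cannon, G. H. Knightly, *A note on the Cauchy problem for the Navier–Stokes equations*,
  SIAM J. Appl. Math. 18 (1970) 641–644 (as cited by Lemarié-Rieusset, ref. [80]).
-/

noncomputable section

open MeasureTheory Set Function Filter TopologicalSpace InnerProductSpace Metric
open _root_.Topology
open scoped RealInnerProductSpace NNReal ENNReal

namespace Literature.Analysis.FluidPDE

variable {E : Type*} [NormedAddCommGroup E] [InnerProductSpace ℝ E] [FiniteDimensional ℝ E]
  [MeasurableSpace E] [BorelSpace E]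

/-! ### Time translation of the Duhamel term -/

section Translate

/-- **Time translation of the Duhamel term**: `B^ν_s(u(· + c), v(· + c))(t) = B^ν_{s+c}(u, v)(t + c)`
(the substitution `τ ↦ τ + c` in the time integral). [folklore] -/
theorem oseenDuhamel_translate (ν s c : ℝ) (u v : ℝ → E → E) (t : ℝ) (x : E) :
    oseenDuhamel ν s (fun τ => u (τ + c)) (fun τ => v (τ + c)) t x =
      oseenDuhamel ν (s + c) u v (t + c) x := by
  simp only [oseenDuhamel_apply]
  have h := (measurePreserving_add_right (volume : Measure ℝ) c).setIntegral_preimage_emb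
    (measurableEmbedding_addRight c)
    (fun τ => ∫ y, oseenKernel (ν * (t + c - τ)) (x - y) (u τ y) (v τ y)) (Ioo (s + c) (t + c))
  rw [preimage_add_const_Ioo, add_sub_cancel_right, add_sub_cancel_right] at h
  rw [← h]
  refine setIntegral_congr_fun measurableSet_Ioo fun τ _ => ?_
  simp only [add_sub_add_right_eq_sub]

end Translate

/-! ### Restart from an arbitrary initial time -/

section Restart

variable {ν s T₁ M : ℝ} {a : E → E} {u : ℝ → E → E}

/-- **Restart of the integral equation from the initial time `s`** (the named fact (R)
`oseenMild_restart`, transported from the initial time `0` by the time translation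
`τ ↦ τ + s`, with the datum `a` placed at the initial slice): a bounded solution of
`u(t) = e^{ν(t-s)Δ}a - B^ν_s(u,u)(t)` on `(s, T₁)` from `a ∈ L^∞` satisfies, for all
`s < s' < t < T₁`, `u(t) = e^{ν(t-s')Δ}u(s') - B^ν_{s'}(u,u)(t)` a.e. (KNSS 2009, §4 p. 8: "(4.3)
can be treated as an ODE in `t`"). [cite: KochNadirashviliSereginSverak2009, §4 p. 8 (arXiv:0709.3599)] -/
theorem restart_of_oseenMild_restart (hR : oseenMild_restart E) (hν : 0 < ν) (hsT : s < T₁)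
    (ha : AEStronglyMeasurable a volume) (haM : eLpNorm a ∞ volume ≤ ENNReal.ofReal M)
    (hum : AEStronglyMeasurable (uncurry u) ((volume : Measure (ℝ × E)).restrict (Ioo s T₁ ×ˢ univ)))
    (huM : ∀ t ∈ Ioo s T₁, eLpNorm (u t) ∞ volume ≤ ENNReal.ofReal M)
    (husol : ∀ t ∈ Ioo s T₁, u t =ᵐ[volume] fun x =>
      UnboundedOperators.heatExtension a (ν * (t - s)) x - oseenDuhamel ν s u u t x) :
    ∀ ⦃s' t : ℝ⦄, s < s' → s' < t → t < T₁ → u t =ᵐ[volume] fun x =>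
      UnboundedOperators.heatExtension (u s') (ν * (t - s')) x - oseenDuhamel ν s' u u t x := by
  classical
  set T : ℝ := T₁ - s with hT
  have hT0 : 0 < T := sub_pos.2 hsT
  -- the translated field with the datum at the initial slice
  set w : ℝ → E → E := fun τ => if τ = 0 then a else u (τ + s) with hw
  have hw0 : w 0 = a := by simp [hw]
  have hwpos : ∀ {τ : ℝ}, 0 < τ → w τ = u (τ + s) := fun {τ} hτ => by simp [hw, hτ.ne']
  -- measurability
  have hwm : AEStronglyMeasurable (uncurry w) ((volume : Measure (ℝ × E)).restrict (Ioo 0 T ×ˢ univ)) := by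
    have h1 : AEStronglyMeasurable (uncurry fun τ => u (τ + s))
        ((volume : Measure (ℝ × E)).restrict (Ioo 0 T ×ˢ univ)) := by
      have hmp := measurePreserving_timeShift_restrict (E := E) s 0 T univ
      rw [zero_add, hT, sub_add_cancel] at hmp
      exact hum.comp_measurePreserving hmp
    refine h1.congr ?_
    refine (ae_restrict_mem (measurableSet_Ioo.prod MeasurableSet.univ)).mono fun p hp => ?_
    have hp1 : 0 < p.1 := (mem_prod.1 hp).1.1
    change u (p.1 + s) p.2 = w p.1 p.2
    rw [hwpos hp1]
  -- bounds, datum included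
  have hwbd : ∀ T' ∈ Ioo 0 T, ∃ C : ℝ≥0∞, C < ∞ ∧ ∀ t ∈ Ico 0 T', eLpNorm (w t) ∞ volume ≤ C := by
    intro T' hT'
    refine ⟨ENNReal.ofReal M, ENNReal.ofReal_lt_top, fun t ht => ?_⟩
    rcases ht.1.eq_or_lt with h | h
    · rw [← h, hw0]; exact haM
    · rw [hwpos h]
      exact huM (t + s) ⟨by linarith, by linarith [ht.2, hT'.2]⟩
  -- the integral equation from the datum at time `0`
  have hwsol : ∀ t ∈ Ioo 0 T, w t =ᵐ[volume] fun x =>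
      UnboundedOperators.heatExtension (w 0) (ν * t) x - oseenDuhamel ν 0 w w t x := by
    intro t ht
    have hts : t + s ∈ Ioo s T₁ := ⟨by linarith [ht.1], by linarith [ht.2]⟩
    have hB : ∀ x, oseenDuhamel ν 0 w w t x = oseenDuhamel ν s u u (t + s) x := by
      intro x
      rw [oseenDuhamel_congr_ae_slice (u' := fun τ => u (τ + s)) (v' := fun τ => u (τ + s))
        (fun τ hτ => by rw [hwpos hτ.1]) (fun τ hτ => by rw [hwpos hτ.1]) x,
        oseenDuhamel_translate, zero_add]
    rw [hwpos ht.1, hw0]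
    filter_upwards [husol (t + s) hts] with x hx
    rw [hx, hB x, add_sub_cancel_right]
  have key := hR hν hT0 hwm (by rw [hw0]; exact ha) hwbd hwsol
  intro s' t hss' hs't htT
  have h1 : 0 < s' - s := sub_pos.2 hss'
  have h2 : s' - s < t - s := by linarith
  have h3 : t - s < T := by rw [hT]; linarith
  have h := key h1 h2 h3
  rw [hwpos (h1.trans h2), hwpos h1, sub_add_cancel, sub_add_cancel] at h
  have hB : ∀ x, oseenDuhamel ν (s' - s) w w (t - s) x = oseenDuhamel ν s' u u t x := by
    intro x
    rw [oseenDuhamel_congr_ae_slice (u' := fun τ => u (τ + s)) (v' := fun τ => u (τ + s))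
      (fun τ hτ => by rw [hwpos (h1.trans hτ.1)]) (fun τ hτ => by rw [hwpos (h1.trans hτ.1)]) x,
      oseenDuhamel_translate, sub_add_cancel, sub_add_cancel]
  filter_upwards [h] with x hx
  rw [hx, hB x, sub_sub_sub_cancel_right]

end Restart

/-! ### Continuity of the slices of the Duhamel term -/

section SliceContinuity

omit [InnerProductSpace ℝ E] [FiniteDimensional ℝ E] [MeasurableSpace E] [BorelSpace E] in
/-- Comparison of the parabolic weights centred at two points at distance `< 1`:
`(σ + ‖x - y‖²)^{-e} ≤ (2 + 2/σ)^e (σ + ‖x₀ - y‖²)^{-e}` for `x ∈ B(x₀, 1)`, `e ≥ 0`, `σ > 0`.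
[folklore] -/
theorem add_norm_sq_rpow_neg_le_of_mem_ball {σ : ℝ} (hσ : 0 < σ) {e : ℝ} (he : 0 ≤ e)
    {x x₀ y : E} (hx : x ∈ ball x₀ 1) :
    (σ + ‖x - y‖ ^ 2) ^ (-e) ≤ (2 + 2 / σ) ^ e * (σ + ‖x₀ - y‖ ^ 2) ^ (-e) := by
  have hL : 0 < 2 + 2 / σ := by positivity
  have h1 : σ + ‖x₀ - y‖ ^ 2 ≤ (2 + 2 / σ) * (σ + ‖x - y‖ ^ 2) := by
    have hxx : ‖x - x₀‖ < 1 := mem_ball_iff_norm.1 hx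
    have htri : ‖x₀ - y‖ ≤ ‖x - y‖ + ‖x - x₀‖ := by
      calc ‖x₀ - y‖ = ‖(x - y) - (x - x₀)‖ := by congr 1; abel
        _ ≤ ‖x - y‖ + ‖x - x₀‖ := norm_sub_le _ _
    have hb1 : ‖x₀ - y‖ ≤ ‖x - y‖ + 1 := by linarith
    have hsq : ‖x₀ - y‖ ^ 2 ≤ 2 * ‖x - y‖ ^ 2 + 2 := by
      have h2 : ‖x₀ - y‖ ^ 2 ≤ (‖x - y‖ + 1) ^ 2 :=
        pow_le_pow_left₀ (norm_nonneg _) hb1 2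
      nlinarith [sq_nonneg (‖x - y‖ - 1)]
    have hσσ : 2 / σ * σ = 2 := div_mul_cancel₀ 2 hσ.ne'
    have hnn : 0 ≤ 2 / σ * ‖x - y‖ ^ 2 := by positivity
    have hexp : (2 + 2 / σ) * (σ + ‖x - y‖ ^ 2) =
        2 * σ + 2 * ‖x - y‖ ^ 2 + 2 / σ * σ + 2 / σ * ‖x - y‖ ^ 2 := by ring
    rw [hexp, hσσ]
    nlinarith [hsq, hnn]
  have hpos₀ : 0 < σ + ‖x₀ - y‖ ^ 2 := by positivity
  have hle : (σ + ‖x₀ - y‖ ^ 2) / (2 + 2 / σ) ≤ σ + ‖x - y‖ ^ 2 := by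
    rw [div_le_iff₀ hL, mul_comm]
    exact h1
  calc (σ + ‖x - y‖ ^ 2) ^ (-e)
      ≤ ((σ + ‖x₀ - y‖ ^ 2) / (2 + 2 / σ)) ^ (-e) :=
        Real.rpow_le_rpow_of_nonpos (div_pos hpos₀ hL) hle (neg_nonpos.2 he)
    _ = (σ + ‖x₀ - y‖ ^ 2) ^ (-e) / (2 + 2 / σ) ^ (-e) := Real.div_rpow hpos₀.le hL.le _
    _ = (2 + 2 / σ) ^ e * (σ + ‖x₀ - y‖ ^ 2) ^ (-e) := by
        rw [Real.rpow_neg hL.le, div_inv_eq_mul, mul_comm]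

/-- **Continuity of a slice of the Oseen operator on bounded data**: for `σ > 0` and bounded
measurable `a`, `b`, the field `x ↦ ∫ K(σ, x-y)[a(y), b(y)] dy` is continuous (dominated
convergence under Koch–Tataru's bound (14), the kernel being continuous in `z`,
`continuous_oseenKernel`). [folklore] -/
theorem continuous_integral_oseenKernel_of_bound {σ : ℝ} (hσ : 0 < σ) {a b : E → E}
    (ha : AEStronglyMeasurable a volume) (hb : AEStronglyMeasurable b volume) {M : ℝ} (hM : 0 ≤ M)
    (haM : ∀ y, ‖a y‖ ≤ M) (hbM : ∀ y, ‖b y‖ ≤ M) :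
    Continuous fun x => ∫ y, oseenKernel σ (x - y) (a y) (b y) := by
  set d : ℝ := (Module.finrank ℝ E : ℝ) with hd
  obtain ⟨C₀, hC₀, hK⟩ := exists_norm_oseenKernel_le (E := E)
  set e : ℝ := (d + 1) / 2 with he
  have he0 : 0 ≤ e := by positivity
  have hde : d < 2 * e := by rw [he]; linarith
  have hmeas : ∀ x, AEStronglyMeasurable (fun y => oseenKernel σ (x - y) (a y) (b y)) volume :=
    fun x => (AEMeasurable.oseenKernel_comp aemeasurable_const
      (measurable_const.sub measurable_id).aemeasurable ha.aemeasurable hb.aemeasurable).aestronglyMeasurable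
  refine continuous_iff_continuousAt.2 fun x₀ => ?_
  set bound : E → ℝ := fun y => C₀ * M * M * ((2 + 2 / σ) ^ e * (σ + ‖x₀ - y‖ ^ 2) ^ (-e))
    with hbound
  refine continuousAt_of_dominated (bound := bound) (Eventually.of_forall hmeas) ?_ ?_ ?_
  · filter_upwards [ball_mem_nhds x₀ one_pos] with x hx
    refine Eventually.of_forall fun y => ?_
    calc ‖oseenKernel σ (x - y) (a y) (b y)‖
        ≤ C₀ * (σ + ‖x - y‖ ^ 2) ^ (-e) * ‖a y‖ * ‖b y‖ := hK hσ _ _ _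
      _ ≤ C₀ * ((2 + 2 / σ) ^ e * (σ + ‖x₀ - y‖ ^ 2) ^ (-e)) * M * M := by
          gcongr
          · exact add_norm_sq_rpow_neg_le_of_mem_ball hσ he0 hx
          · exact haM y
          · exact hbM y
      _ = bound y := by rw [hbound]; ring
  · have h1 : Integrable (fun z : E => (σ + ‖z‖ ^ 2) ^ (-e)) := integrable_add_norm_sq_rpow_neg hde hσ
    have h2 : Integrable (fun y : E => (σ + ‖x₀ - y‖ ^ 2) ^ (-e)) :=
      (Measure.measurePreserving_sub_left volume x₀).integrable_comp_of_integrable h1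
    exact (h2.const_mul _).const_mul _
  · refine Eventually.of_forall fun y => ?_
    exact ((continuous_oseenKernel hσ (a y) (b y)).comp (continuous_id.sub continuous_const)).continuousAt

/-- `τ ↦ (t - τ)^{-1/2}` is integrable on `(s, t)`. [folklore] -/
theorem integrableOn_Ioo_rpow_neg_half_sub (s t : ℝ) :
    IntegrableOn (fun τ : ℝ => (t - τ) ^ (-(1 / 2 : ℝ))) (Ioo s t) := by
  have h := (intervalIntegral.intervalIntegrable_rpow' (a := t - s) (b := 0)
    (show (-1 : ℝ) < -(1 / 2) by norm_num)).comp_sub_left t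
  rw [sub_sub_cancel, sub_zero] at h
  exact h.1.mono_set Ioo_subset_Ioc_self

variable {ν s T M : ℝ} {u v : ℝ → E → E}

/-- **Continuity of the slices of the Duhamel term of bounded fields**: for `u`, `v` jointly
measurable and bounded by `M` on `(s, T) × E`, `ν > 0` and `s < t ≤ T`, the slice
`x ↦ B^ν_s(u,v)(t)(x)` is continuous (dominated convergence in the time integral, under the
majorant `C (ν(t-τ))^{-1/2} 2M²`, of the continuous slices of the Oseen operator). [folklore] -/
theorem continuous_oseenDuhamel_slice (hν : 0 < ν) (hM : 0 ≤ M)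
    (hum : AEStronglyMeasurable (uncurry u) ((volume : Measure (ℝ × E)).restrict (Ioo s T ×ˢ univ)))
    (hvm : AEStronglyMeasurable (uncurry v) ((volume : Measure (ℝ × E)).restrict (Ioo s T ×ˢ univ)))
    (huM : ∀ τ ∈ Ioo s T, ∀ y, ‖u τ y‖ ≤ M) (hvM : ∀ τ ∈ Ioo s T, ∀ y, ‖v τ y‖ ≤ M)
    {t : ℝ} (hst : s < t) (htT : t ≤ T) :
    Continuous (oseenDuhamel ν s u v t) := by
  obtain ⟨C, hC, hCK⟩ := exists_lintegral_enorm_oseenKernel_sub_le (E := E)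
  have hsub : Ioo s t ×ˢ (univ : Set E) ⊆ Ioo s T ×ˢ univ :=
    prod_mono (Ioo_subset_Ioo_right htT) subset_rfl
  have hum' : AEStronglyMeasurable (uncurry u) ((volume.restrict (Ioo s t)).prod (volume : Measure E)) := by
    rw [← volume_restrict_prod_univ_eq_prod]
    exact hum.mono_measure (Measure.restrict_mono hsub le_rfl)
  have hvm' : AEStronglyMeasurable (uncurry v) ((volume.restrict (Ioo s t)).prod (volume : Measure E)) := by
    rw [← volume_restrict_prod_univ_eq_prod]
    exact hvm.mono_measure (Measure.restrict_mono hsub le_rfl)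
  have hI : ∀ x : E, Integrable
      (fun p : ℝ × E => oseenKernel (ν * (t - p.1)) (x - p.2) (u p.1 p.2) (v p.1 p.2))
      ((volume.restrict (Ioo s t)).prod (volume : Measure E)) := fun x => by
    rw [← volume_restrict_prod_univ_eq_prod]
    exact integrable_oseenKernel_duhamel_bounded hν hum hvm hM huM hvM hst htT x
  set K₁ : ℝ := C * ν ^ (-(1 / 2 : ℝ)) * (2 * M * M) with hK₁
  have hK₁0 : 0 ≤ K₁ := by positivity
  change Continuous fun x => oseenDuhamel ν s u v t x
  simp only [oseenDuhamel_apply]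
  refine continuous_of_dominated (fun x => (hI x).integral_prod_left.aestronglyMeasurable) ?_
    (((integrableOn_Ioo_rpow_neg_half_sub s t).const_mul K₁)) ?_
  · intro x
    refine (ae_restrict_mem measurableSet_Ioo).mono fun τ hτ => ?_
    have hσ : 0 < ν * (t - τ) := mul_pos hν (sub_pos.2 hτ.2)
    have hτT : τ ∈ Ioo s T := ⟨hτ.1, hτ.2.trans_le htT⟩
    have hlin := hCK hσ hM hM (a := u τ) (a' := fun _ => 0) (b := v τ) (b' := fun _ => 0)
      (fun _ => by simpa using hM) (hvM τ hτT)
      (Eventually.of_forall fun y => by simpa using huM τ hτT y)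
      (Eventually.of_forall fun y => by simpa using hvM τ hτT y) x
    simp only [oseenKernel_zero_left, sub_zero] at hlin
    calc ‖∫ y, oseenKernel (ν * (t - τ)) (x - y) (u τ y) (v τ y)‖
        ≤ (∫⁻ y, ‖oseenKernel (ν * (t - τ)) (x - y) (u τ y) (v τ y)‖ₑ).toReal := by
          have h := norm_integral_le_lintegral_norm
            (fun y => oseenKernel (ν * (t - τ)) (x - y) (u τ y) (v τ y)) (μ := volume)
          simpa only [ofReal_norm] using h
      _ ≤ C * (ν * (t - τ)) ^ (-(1 / 2 : ℝ)) * (2 * M * M) :=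
          ENNReal.toReal_le_of_le_ofReal (by positivity) hlin
      _ = K₁ * (t - τ) ^ (-(1 / 2 : ℝ)) := by
          rw [hK₁, Real.mul_rpow hν.le (sub_pos.2 hτ.2).le]
          ring
  · filter_upwards [hum'.prodMk_left, hvm'.prodMk_left, ae_restrict_mem measurableSet_Ioo] with τ hτu hτv hτ
    have hσ : 0 < ν * (t - τ) := mul_pos hν (sub_pos.2 hτ.2)
    have hτT : τ ∈ Ioo s T := ⟨hτ.1, hτ.2.trans_le htT⟩
    exact continuous_integral_oseenKernel_of_bound hσ hτu hτv hM (huM τ hτT) (hvM τ hτT)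

/-- **An essential bound is a pointwise bound for a continuous representative**: if `g` is
continuous, `g = f` a.e. and `‖f‖_{L^∞} ≤ M`, then `‖g(x)‖ ≤ M` for every `x` (open null sets
are empty). [folklore] -/
theorem norm_le_of_continuous_of_ae_eq
    {f g : E → E} {M : ℝ} (hM : 0 ≤ M) (hg : Continuous g)
    (hfg : g =ᵐ[volume] f) (hf : eLpNorm f ∞ volume ≤ ENNReal.ofReal M) (x : E) : ‖g x‖ ≤ M := by
  have h1 : ∀ᵐ y ∂(volume : Measure E), ‖g y‖ ≤ M := by
    filter_upwards [hfg, ae_norm_le_of_eLpNorm_top_le hM hf] with y hy hy'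
    rw [hy]; exact hy'
  set φ : E → ℝ := fun y => max (‖g y‖ - M) 0 with hφ
  have hφc : Continuous φ := by fun_prop
  have hφ0 : φ =ᵐ[volume] fun _ => (0 : ℝ) := by
    filter_upwards [h1] with y hy
    simp [hφ, hy]
  have hφeq : φ = fun _ => (0 : ℝ) := (hφc.ae_eq_iff_eq volume continuous_const).1 hφ0
  have hx : φ x = 0 := congr_fun hφeq x
  have hx' : max (‖g x‖ - M) 0 = 0 := hx
  have : ‖g x‖ - M ≤ 0 := by
    have := le_max_left (‖g x‖ - M) 0
    rwa [hx'] at this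
  linarith

end SliceContinuity

/-! ### The named fact: the local theory (KNSS 2009, Prop. 4.1, quantitative form) -/

section LocalFact

variable (E)

/-- **(L) KNSS 2009, Proposition 4.1: smooth local solutions from bounded data, with the
parabolic smoothing estimates** (Koch–Nadirashvili–Seregin–Šverák, Acta Math. 203 (2009) =
arXiv:0709.3599, §4 p. 8: the equation `u = U + B(u,u)` ((4.3)) "can be solved in
`L^∞_{x,t}(ℝⁿ × (0,T))` for sufficiently small `T` by a fixed point argument, since [the kernel
bound] easily implies `‖B(u,v)‖ ≤ C√T ‖u‖ ‖v‖`" ((4.4)), and Prop. 4.1: "for `k, l = 0, 1, …` the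
functions `t^{k/2+l}∇ᵏₓ∂ₜˡu` are bounded and, for `T' = ε(k,l)‖u₀‖^{-2}_{L^∞}` (where `ε(k,l) > 0`
is a small constant), we have `‖t^{k/2+l}∇ᵏₓ∂ₜˡu‖_{L^∞(ℝⁿ×(0,T'))} ≤ C(k,l)‖u₀‖_{L^∞}`" ((4.5));
the smoothness of the local solution in `(t, x)` is Lemarié-Rieusset 2016, Thm. 9.12 and its
proof, pp. 260–263: for `t ∈ (t₀, t₀ + (4C₀‖u(t₀)‖_∞)^{-2})` the bounded mild solution is the
sum of the Oseen series (9.38), holomorphic on a complex parabolic neighbourhood, hence analytic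
in time and space). **Statement**, for general viscosity `ν > 0` (a time rescaling of the
printed `ν = 1`), initial time `s`, any finite-dimensional `E`: for all `k, l` there are
`ε = ε(k,l,E) > 0` and `C = C(k,l,E) ≥ 0` such that for every `a ∈ L^∞(E)` with
`‖a‖_{L^∞} ≤ M` (`0 < M`) there is a field `v`, jointly `C^{k+l}` on
`(s, s + εν/M²) × E`, solving `v(t,x) = e^{ν(t-s)Δ}a(x) - B^ν_s(v,v)(t)(x)` there pointwise,
with `‖v‖ ≤ C M` and `(ν(t-s))^{k/2} (t-s)^l ‖∇ᵏₓ ∂ₜˡ v(t,x)‖ ≤ C M` on `(s, s + εν/M²) × E`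
(`∇ᵏₓ∂ₜˡv` = `iteratedFDeriv ℝ k (fun y => iteratedDeriv l (v · y) t) x`). The printed
solution is unique among bounded solutions (`oseenMild_bounded_unique`), which identifies `v`
with any given bounded mild solution. [cite: KochNadirashviliSereginSverak2009, Prop. 4.1 with (4.3)–(4.5) (arXiv:0709.3599 p. 8)] -/
def knss2009_local_smoothing : Prop :=
  ∀ k l : ℕ, ∃ ε : ℝ, 0 < ε ∧ ∃ C : ℝ, 0 ≤ C ∧
    ∀ ⦃ν : ℝ⦄, 0 < ν → ∀ (s : ℝ) ⦃M : ℝ⦄, 0 < M → ∀ ⦃a : E → E⦄,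
      AEStronglyMeasurable a volume → eLpNorm a ∞ volume ≤ ENNReal.ofReal M →
      ∃ v : ℝ → E → E,
        ContDiffOn ℝ (k + l : ℕ) (uncurry v) (Ioo s (s + ε * ν / M ^ 2) ×ˢ univ) ∧
        (∀ t ∈ Ioo s (s + ε * ν / M ^ 2), ∀ x,
          v t x = UnboundedOperators.heatExtension a (ν * (t - s)) x - oseenDuhamel ν s v v t x) ∧
        (∀ t ∈ Ioo s (s + ε * ν / M ^ 2), ∀ x, ‖v t x‖ ≤ C * M) ∧
        ∀ t ∈ Ioo s (s + ε * ν / M ^ 2), ∀ x,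
          (ν * (t - s)) ^ ((k : ℝ) / 2) * (t - s) ^ l *
            ‖iteratedFDeriv ℝ k (fun y => iteratedDeriv l (fun τ => v τ y) t) x‖ ≤ C * M

end LocalFact

/-! ### Local smooth representatives (the local theory and uniqueness) -/

section Window

variable {ν s' T₁ Mp ε C : ℝ} {k l : ℕ} {a' : E → E} {u : ℝ → E → E}

/-- **The local smooth representative.** Let `ε, C` be the constants of (L) for `(k, l)`, let
`u` be jointly measurable on `(s', T₁) × E` with slices essentially bounded by `Mp`, solving
`u(t) = e^{ν(t-s')Δ}a' - B^ν_{s'}(u,u)(t)` a.e. for `t ∈ (s', T₁)` from a datum `a'` with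
`‖a'‖_{L^∞} ≤ Mp`. Then the smooth local solution `v` of (L) from `a'` at time `s'` agrees
with `u` a.e. on every slice of `(s', min(s' + εν/Mp², T₁))` (uniqueness of bounded solutions,
`oseenMild_essBounded_unique`), and the representative `e^{ν(t-s')Δ}a' - B^ν_{s'}(u,u)(t)` *is*
`v(t)` there, pointwise (the Duhamel term only sees a.e. classes of slices). [cite: KochNadirashviliSereginSverak2009, Prop. 4.1 (arXiv:0709.3599 p. 8)] -/
theorem exists_local_smooth_representative
    (hLkl : ∀ ⦃ν : ℝ⦄, 0 < ν → ∀ (s : ℝ) ⦃M : ℝ⦄, 0 < M → ∀ ⦃a : E → E⦄,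
      AEStronglyMeasurable a volume → eLpNorm a ∞ volume ≤ ENNReal.ofReal M →
      ∃ v : ℝ → E → E,
        ContDiffOn ℝ (k + l : ℕ) (uncurry v) (Ioo s (s + ε * ν / M ^ 2) ×ˢ univ) ∧
        (∀ t ∈ Ioo s (s + ε * ν / M ^ 2), ∀ x,
          v t x = UnboundedOperators.heatExtension a (ν * (t - s)) x - oseenDuhamel ν s v v t x) ∧
        (∀ t ∈ Ioo s (s + ε * ν / M ^ 2), ∀ x, ‖v t x‖ ≤ C * M) ∧
        ∀ t ∈ Ioo s (s + ε * ν / M ^ 2), ∀ x,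
          (ν * (t - s)) ^ ((k : ℝ) / 2) * (t - s) ^ l *
            ‖iteratedFDeriv ℝ k (fun y => iteratedDeriv l (fun τ => v τ y) t) x‖ ≤ C * M)
    (hν : 0 < ν) (hMp : 0 < Mp) (hC : 0 ≤ C)
    (ha' : AEStronglyMeasurable a' volume) (ha'M : eLpNorm a' ∞ volume ≤ ENNReal.ofReal Mp)
    (hum : AEStronglyMeasurable (uncurry u) ((volume : Measure (ℝ × E)).restrict (Ioo s' T₁ ×ˢ univ)))
    (huM : ∀ t ∈ Ioo s' T₁, eLpNorm (u t) ∞ volume ≤ ENNReal.ofReal Mp)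
    (husol : ∀ t ∈ Ioo s' T₁, u t =ᵐ[volume] fun x =>
      UnboundedOperators.heatExtension a' (ν * (t - s')) x - oseenDuhamel ν s' u u t x) :
    ∃ v : ℝ → E → E,
      ContDiffOn ℝ (k + l : ℕ) (uncurry v) (Ioo s' (s' + ε * ν / Mp ^ 2) ×ˢ univ) ∧
      (∀ t ∈ Ioo s' (min (s' + ε * ν / Mp ^ 2) T₁), u t =ᵐ[volume] v t) ∧
      (∀ t ∈ Ioo s' (min (s' + ε * ν / Mp ^ 2) T₁), ∀ x,
        UnboundedOperators.heatExtension a' (ν * (t - s')) x - oseenDuhamel ν s' u u t x = v t x) ∧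
      (∀ t ∈ Ioo s' (s' + ε * ν / Mp ^ 2), ∀ x, ‖v t x‖ ≤ C * Mp) ∧
      ∀ t ∈ Ioo s' (s' + ε * ν / Mp ^ 2), ∀ x,
        (ν * (t - s')) ^ ((k : ℝ) / 2) * (t - s') ^ l *
          ‖iteratedFDeriv ℝ k (fun y => iteratedDeriv l (fun τ => v τ y) t) x‖ ≤ C * Mp := by
  obtain ⟨v, hvs, hveq, hvM, hvbd⟩ := hLkl hν s' hMp ha' ha'M
  set h : ℝ := ε * ν / Mp ^ 2 with hh
  set T' : ℝ := min (s' + h) T₁ with hT'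
  have hT'T₁ : T' ≤ T₁ := min_le_right _ _
  have hT'h : T' ≤ s' + h := min_le_left _ _
  -- uniqueness on `(s', T')`
  have hae : ∀ t ∈ Ioo s' T', u t =ᵐ[volume] v t := by
    have hsub : Ioo s' T' ×ˢ (univ : Set E) ⊆ Ioo s' T₁ ×ˢ univ :=
      prod_mono (Ioo_subset_Ioo_right hT'T₁) subset_rfl
    have hsub' : Ioo s' T' ×ˢ (univ : Set E) ⊆ Ioo s' (s' + h) ×ˢ univ :=
      prod_mono (Ioo_subset_Ioo_right hT'h) subset_rfl
    -- the local solution as a bounded solution on `(s', T')`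
    have hvm : AEStronglyMeasurable (uncurry v)
        ((volume : Measure (ℝ × E)).restrict (Ioo s' T' ×ˢ univ)) :=
      (hvs.continuousOn.mono hsub').aestronglyMeasurable (measurableSet_Ioo.prod MeasurableSet.univ)
    set M' : ℝ := Mp + C * Mp with hM'
    have hCM : 0 ≤ C * Mp := mul_nonneg hC hMp.le
    have hMpM' : ENNReal.ofReal Mp ≤ ENNReal.ofReal M' :=
      ENNReal.ofReal_le_ofReal (by rw [hM']; linarith)
    have hvM' : ∀ t ∈ Ioo s' T', eLpNorm (v t) ∞ volume ≤ ENNReal.ofReal M' := by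
      intro t ht
      rw [eLpNorm_exponent_top]
      refine eLpNormEssSup_le_of_ae_bound (Eventually.of_forall fun x => ?_)
      have := hvM t ⟨ht.1, ht.2.trans_le hT'h⟩ x
      rw [hM']; linarith
    have huM' : ∀ t ∈ Ioo s' T', eLpNorm (u t) ∞ volume ≤ ENNReal.ofReal M' :=
      fun t ht => (huM t ⟨ht.1, ht.2.trans_le hT'T₁⟩).trans hMpM'
    have hvsol : ∀ t ∈ Ioo s' T', v t =ᵐ[volume] fun x =>
        UnboundedOperators.heatExtension a' (ν * (t - s')) x - oseenDuhamel ν s' v v t x :=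
      fun t ht => Eventually.of_forall fun x => hveq t ⟨ht.1, ht.2.trans_le hT'h⟩ x
    exact oseenMild_essBounded_unique (U := fun t x =>
        UnboundedOperators.heatExtension a' (ν * (t - s')) x) hν (by rw [hM']; positivity)
      (hum.mono_measure (Measure.restrict_mono hsub le_rfl)) hvm huM' hvM'
      (fun t ht => husol t ⟨ht.1, ht.2.trans_le hT'T₁⟩) hvsol
  refine ⟨v, hvs, hae, fun t ht x => ?_, hvM, hvbd⟩
  have hB : oseenDuhamel ν s' u u t x = oseenDuhamel ν s' v v t x :=
    oseenDuhamel_congr_ae_slice (fun τ hτ => hae τ ⟨hτ.1, hτ.2.trans ht.2⟩)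
      (fun τ hτ => hae τ ⟨hτ.1, hτ.2.trans ht.2⟩) x
  rw [hB, hveq t ⟨ht.1, ht.2.trans_le hT'h⟩ x]

end Window

/-! ### The smoothing fact from the restart fact and the local theory -/

section Assembly

omit [InnerProductSpace ℝ E] [FiniteDimensional ℝ E] [MeasurableSpace E] [BorelSpace E] in
/-- **Mixed partial derivatives are local in time**: if `w(τ, y) = v(τ, y)` for all `τ` in an
open set `J ∋ t` and all `y`, then `∇ᵏ_y ∂ₜˡ w (t, x) = ∇ᵏ_y ∂ₜˡ v (t, x)`. [folklore] -/
theorem iteratedFDeriv_iteratedDeriv_congr [NormedSpace ℝ E] {w v : ℝ → E → E} {J : Set ℝ}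
    (hJ : IsOpen J) {t : ℝ} (ht : t ∈ J) (h : ∀ τ ∈ J, ∀ y, w τ y = v τ y) (k l : ℕ) (x : E) :
    iteratedFDeriv ℝ k (fun y => iteratedDeriv l (fun τ => w τ y) t) x =
      iteratedFDeriv ℝ k (fun y => iteratedDeriv l (fun τ => v τ y) t) x := by
  have hfun : (fun y => iteratedDeriv l (fun τ => w τ y) t) =
      fun y => iteratedDeriv l (fun τ => v τ y) t := by
    funext y
    refine Filter.EventuallyEq.iteratedDeriv_eq l ?_
    filter_upwards [hJ.mem_nhds ht] with τ hτ
    exact h τ hτ y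
  rw [hfun]

/-- **KNSS 2009, Prop. 4.1 from the restart fact (R) and the local theory (L).** Let `u` be a
bounded solution of `u(t) = e^{ν(t-s)Δ}a - B^ν_s(u,u)(t)` on `(s, T₁)` from `a ∈ L^∞` and let
`w(t) = e^{ν(t-s)Δ}a - B^ν_s(u,u)(t)` be its canonical representative. (i) `w(t) = u(t)` a.e.,
the slices of `w` are continuous (the caloric extension of bounded data is smooth; the Duhamel
slices of bounded fields are continuous), hence `‖w‖ ≤ M` everywhere. (ii) Near the initial time,
`t < s + h`, `h = εν/(M+1)²`: the smooth local solution `v` of (L) from `a` at `s` is a bounded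
solution, so `u = v` a.e. slice-wise (uniqueness, `oseenMild_bounded_unique`) and `w = v`
pointwise. (iii) At `t ≥ s + h`: restart at `s' = t - h/2` ((R), from the continuous bounded datum
`w(s')`, `e^{ν(t-s')Δ}u(s') = e^{ν(t-s')Δ}w(s')`), the local solution `v'` from `w(s')` at `s'`
agrees with `u`, hence with `w`, a.e. on the slices of `(s', s'+h) ∩ (s', T₁)`, and continuous
slices a.e. equal coincide: `w = v'` there. (iv) So `w` is jointly `C^n` near every point of
`(s, T₁) × E` for every `n`, i.e. jointly `C^∞`; the weighted bounds are those of (L): sharp on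
`(s, s+h)` (`(t-s)^{k/2+l}‖∇ᵏ∂ₜˡw‖ ≤ ν^{-k/2} C (M+1)`) and constant on `[s+h, T₁)` (windows of
fixed length `h`, weights evaluated at `t - s' = h/2`). This is the covering argument of KNSS
2009, §4 (Prop. 4.1 for all `T`: "the functions `t^{k/2+l}∇ᵏₓ∂ₜˡu` are bounded") and of
Lemarié-Rieusset 2016, Thm. 9.12 (`⋃_{t₀} t₀ + Ω_{γ,M₀}`). [cite: KochNadirashviliSereginSverak2009, Prop. 4.1 (arXiv:0709.3599 p. 8)] -/
theorem knss2009_smoothing_of_local (hR : oseenMild_restart E) (hL : knss2009_local_smoothing E) :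
    knss2009_smoothing E := by
  intro ν hν s T₁ hsT a u M hM ha haM hum huM husol
  set w : ℝ → E → E := fun t x =>
    UnboundedOperators.heatExtension a (ν * (t - s)) x - oseenDuhamel ν s u u t x with hw
  -- (0) `w(t) = u(t)` a.e.
  have hwu : ∀ t ∈ Ioo s T₁, w t =ᵐ[volume] u t := fun t ht => (husol t ht).symm
  -- a bounded representative `ub` of `u` (radius `M + 1`), for the continuity of the slices
  have hM1 : 0 < M + 1 := by linarith
  set ρ : E → E := fun z => ((M + 1) / max (M + 1) ‖z‖) • z with hρ
  have hρc : Continuous ρ := continuous_radialRetract hM1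
  set ub : ℝ → E → E := fun τ y => ρ (u τ y) with hub
  have hubu : ∀ τ ∈ Ioo s T₁, ub τ =ᵐ[volume] u τ := fun τ hτ => by
    filter_upwards [ae_norm_le_of_eLpNorm_top_le hM (huM τ hτ)] with y hy
    exact radialRetract_eq_self hM1 (by linarith)
  have hubm : AEStronglyMeasurable (uncurry ub)
      ((volume : Measure (ℝ × E)).restrict (Ioo s T₁ ×ˢ univ)) :=
    hρc.comp_aestronglyMeasurable hum
  have hubM : ∀ τ ∈ Ioo s T₁, ∀ y, ‖ub τ y‖ ≤ M + 1 := fun τ _ y => norm_radialRetract_le hM1 _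
  have hBub : ∀ t ∈ Ioo s T₁, oseenDuhamel ν s u u t = oseenDuhamel ν s ub ub t := fun t ht => by
    funext x
    exact oseenDuhamel_congr_ae_slice (fun τ hτ => (hubu τ ⟨hτ.1, hτ.2.trans ht.2⟩).symm)
      (fun τ hτ => (hubu τ ⟨hτ.1, hτ.2.trans ht.2⟩).symm) x
  -- (1) continuity of the slices of `w`
  have haLp : MemLp a ∞ volume := ⟨ha, haM.trans_lt ENNReal.ofReal_lt_top⟩
  have hwcont : ∀ t ∈ Ioo s T₁, Continuous (w t) := by
    intro t ht
    have h1 : Continuous (UnboundedOperators.heatExtension a (ν * (t - s))) :=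
      (UnboundedOperators.contDiff_heatExtension_holds haLp le_top
        (mul_pos hν (sub_pos.2 ht.1))).continuous
    have h2 : Continuous (oseenDuhamel ν s ub ub t) :=
      continuous_oseenDuhamel_slice hν hM1.le hubm hubm hubM hubM ht.1 ht.2.le
    have h3 : w t = fun x =>
        UnboundedOperators.heatExtension a (ν * (t - s)) x - oseenDuhamel ν s ub ub t x := by
      funext x
      simp only [hw, hBub t ht]
    rw [h3]
    exact h1.sub h2
  -- (2) the bound `‖w(t, x)‖ ≤ M`
  have hwM : ∀ t ∈ Ioo s T₁, ∀ x, ‖w t x‖ ≤ M := fun t ht x =>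
    norm_le_of_continuous_of_ae_eq hM (hwcont t ht) (hwu t ht) (huM t ht) x
  have hwMp : ∀ t ∈ Ioo s T₁, eLpNorm (w t) ∞ volume ≤ ENNReal.ofReal (M + 1) := fun t ht => by
    rw [eLpNorm_exponent_top]
    exact eLpNormEssSup_le_of_ae_bound
      (Eventually.of_forall fun x => (hwM t ht x).trans (by linarith))
  have huMp : ∀ t ∈ Ioo s T₁, eLpNorm (u t) ∞ volume ≤ ENNReal.ofReal (M + 1) :=
    fun t ht => (huM t ht).trans (ENNReal.ofReal_le_ofReal (by linarith))
  have haMp : eLpNorm a ∞ volume ≤ ENNReal.ofReal (M + 1) :=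
    haM.trans (ENNReal.ofReal_le_ofReal (by linarith))
  -- (3) restart at every `s' ∈ (s, T₁)`, from the continuous datum `w(s')`
  have hrestart : ∀ ⦃s' : ℝ⦄, s < s' → s' < T₁ → ∀ t ∈ Ioo s' T₁, u t =ᵐ[volume] fun x =>
      UnboundedOperators.heatExtension (w s') (ν * (t - s')) x - oseenDuhamel ν s' u u t x := by
    intro s' hss' hs'T t ht
    have h := restart_of_oseenMild_restart hR hν hsT ha haM hum huM husol hss' ht.1 ht.2
    rw [← heatExtension_congr_ae (hwu s' ⟨hss', hs'T⟩) (ν * (t - s'))] at h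
    exact h
  -- (4) the local windows for `(k, l)`: from `s` (datum `a`) and from `s' ∈ (s, T₁)` (datum `w s'`)
  have hwin : ∀ k l : ℕ, ∃ h : ℝ, 0 < h ∧ ∃ C : ℝ, 0 ≤ C ∧
      (∃ v : ℝ → E → E, ContDiffOn ℝ (k + l : ℕ) (uncurry v) (Ioo s (s + h) ×ˢ univ) ∧
        (∀ t ∈ Ioo s (min (s + h) T₁), ∀ y, w t y = v t y) ∧
        ∀ t ∈ Ioo s (s + h), ∀ x, (ν * (t - s)) ^ ((k : ℝ) / 2) * (t - s) ^ l *
          ‖iteratedFDeriv ℝ k (fun y => iteratedDeriv l (fun τ => v τ y) t) x‖ ≤ C) ∧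
      ∀ ⦃s' : ℝ⦄, s < s' → s' < T₁ → ∃ v : ℝ → E → E,
        ContDiffOn ℝ (k + l : ℕ) (uncurry v) (Ioo s' (s' + h) ×ˢ univ) ∧
        (∀ t ∈ Ioo s' (min (s' + h) T₁), ∀ y, w t y = v t y) ∧
        ∀ t ∈ Ioo s' (s' + h), ∀ x, (ν * (t - s')) ^ ((k : ℝ) / 2) * (t - s') ^ l *
          ‖iteratedFDeriv ℝ k (fun y => iteratedDeriv l (fun τ => v τ y) t) x‖ ≤ C := by
    intro k l
    obtain ⟨ε, hε, C, hC, hLkl⟩ := hL k l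
    refine ⟨ε * ν / (M + 1) ^ 2, by positivity, C * (M + 1), by positivity, ?_, ?_⟩
    · obtain ⟨v, hvs, -, hrep, -, hvbd⟩ :=
        exists_local_smooth_representative hLkl hν hM1 hC ha haMp hum huMp husol
      exact ⟨v, hvs, fun t ht y => hrep t ht y, hvbd⟩
    · intro s' hss' hs'T
      have hws'm : AEStronglyMeasurable (w s') volume :=
        (hwcont s' ⟨hss', hs'T⟩).aestronglyMeasurable
      have hum' : AEStronglyMeasurable (uncurry u)
          ((volume : Measure (ℝ × E)).restrict (Ioo s' T₁ ×ˢ univ)) :=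
        hum.mono_measure (Measure.restrict_mono
          (prod_mono (Ioo_subset_Ioo_left hss'.le) subset_rfl) le_rfl)
      obtain ⟨v, hvs, hae, -, -, hvbd⟩ := exists_local_smooth_representative hLkl hν hM1 hC hws'm
        (hwMp s' ⟨hss', hs'T⟩) hum' (fun t ht => huMp t ⟨hss'.trans ht.1, ht.2⟩)
        (hrestart hss' hs'T)
      refine ⟨v, hvs, fun t ht y => ?_, hvbd⟩
      -- `w t = v t` a.e., and both slices are continuous
      have htT : t ∈ Ioo s T₁ := ⟨hss'.trans ht.1, ht.2.trans_le (min_le_right _ _)⟩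
      have hth : t ∈ Ioo s' (s' + ε * ν / (M + 1) ^ 2) := ⟨ht.1, ht.2.trans_le (min_le_left _ _)⟩
      have h1 : w t =ᵐ[volume] v t := (hwu t htT).trans (hae t ht)
      have hvc : Continuous (v t) :=
        hvs.continuousOn.comp_continuous (f := fun y : E => (t, y)) (by fun_prop)
          (fun y => mk_mem_prod hth (mem_univ y))
      exact congr_fun (((hwcont t htT).ae_eq_iff_eq volume hvc).1 h1) y
  -- (5) the three conclusions
  refine ⟨?_, hwM, ?_⟩
  · -- joint smoothness: jointly `C^n` near every point of the slab, for every `n`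
    change ContDiffOn ℝ ((⊤ : ℕ∞) : WithTop ℕ∞) (uncurry w) (Ioo s T₁ ×ˢ univ)
    refine contDiffOn_infty.2 fun n => ?_
    obtain ⟨h, hh, C, -, hwin0, hwin1⟩ := hwin n 0
    refine contDiffOn_of_locally_contDiffOn fun p hp => ?_
    obtain ⟨hpt, -⟩ := mem_prod.1 hp
    -- the window containing `p.1`
    have hcover : ∃ s' : ℝ, s ≤ s' ∧ p.1 ∈ Ioo s' (min (s' + h) T₁) ∧ ∃ v : ℝ → E → E,
        ContDiffOn ℝ (n + 0 : ℕ) (uncurry v) (Ioo s' (s' + h) ×ˢ univ) ∧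
        ∀ t ∈ Ioo s' (min (s' + h) T₁), ∀ y, w t y = v t y := by
      by_cases hcase : p.1 < s + h
      · obtain ⟨v, hvs, hwv, -⟩ := hwin0
        exact ⟨s, le_rfl, ⟨hpt.1, lt_min hcase hpt.2⟩, v, hvs, hwv⟩
      · rw [not_lt] at hcase
        have hss' : s < p.1 - h / 2 := by linarith
        have hs'T : p.1 - h / 2 < T₁ := by linarith [hpt.2]
        obtain ⟨v, hvs, hwv, -⟩ := hwin1 hss' hs'T
        exact ⟨p.1 - h / 2, hss'.le, ⟨by linarith, lt_min (by linarith) hpt.2⟩, v, hvs, hwv⟩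
    obtain ⟨s', hss', hps', v, hvs, hwv⟩ := hcover
    refine ⟨Ioo s' (min (s' + h) T₁) ×ˢ univ, isOpen_Ioo.prod isOpen_univ,
      mk_mem_prod hps' (mem_univ _), ?_⟩
    have hsub : Ioo s T₁ ×ˢ (univ : Set E) ∩ Ioo s' (min (s' + h) T₁) ×ˢ univ =
        Ioo s' (min (s' + h) T₁) ×ˢ univ := by
      rw [inter_eq_right]
      exact prod_mono (Ioo_subset_Ioo hss' (min_le_right _ _)) subset_rfl
    rw [hsub]
    have hvs' : ContDiffOn ℝ (n : ℕ) (uncurry v) (Ioo s' (min (s' + h) T₁) ×ˢ univ) := by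
      have h' := hvs.mono (prod_mono (Ioo_subset_Ioo_right (min_le_left (s' + h) T₁))
        (subset_refl (univ : Set E)))
      simpa only [add_zero] using h'
    refine hvs'.congr fun q hq => ?_
    obtain ⟨hq1, -⟩ := mem_prod.1 hq
    exact hwv q.1 hq1 q.2
  · -- the weighted bounds
    intro k l
    change ∃ C : ℝ, ∀ t ∈ Ioo s T₁, ∀ x, (t - s) ^ ((k : ℝ) / 2 + l) *
      ‖iteratedFDeriv ℝ k (fun y => iteratedDeriv l (fun τ => w τ y) t) x‖ ≤ C
    obtain ⟨h, hh, C, hC, hwin0, hwin1⟩ := hwin k l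
    obtain ⟨v₀, -, hwv₀, hbd₀⟩ := hwin0
    set P : ℝ := (ν * (h / 2)) ^ ((k : ℝ) / 2) * (h / 2) ^ l with hP
    have hP0 : 0 < P := by positivity
    set C₁ : ℝ := ν ^ (-((k : ℝ) / 2)) * C with hC₁
    set C₂ : ℝ := (T₁ - s) ^ ((k : ℝ) / 2 + l) * (C / P) with hC₂
    have hC₁0 : 0 ≤ C₁ := by positivity
    have hC₂0 : 0 ≤ C₂ := by positivity
    refine ⟨C₁ + C₂, fun t ht x => ?_⟩
    have hτ : 0 < t - s := sub_pos.2 ht.1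
    by_cases hcase : t < s + h
    · -- the initial window: sharp weights
      have htw : t ∈ Ioo s (min (s + h) T₁) := ⟨ht.1, lt_min hcase ht.2⟩
      rw [iteratedFDeriv_iteratedDeriv_congr isOpen_Ioo htw hwv₀ k l x]
      have hb := hbd₀ t ⟨ht.1, hcase⟩ x
      have e1 : (t - s) ^ ((k : ℝ) / 2 + l) =
          ν ^ (-((k : ℝ) / 2)) * ((ν * (t - s)) ^ ((k : ℝ) / 2) * (t - s) ^ l) := by
        rw [Real.rpow_add hτ, Real.rpow_natCast, Real.mul_rpow hν.le hτ.le, Real.rpow_neg hν.le]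
        have : ν ^ ((k : ℝ) / 2) ≠ 0 := (Real.rpow_pos_of_pos hν _).ne'
        field_simp
      calc (t - s) ^ ((k : ℝ) / 2 + l) *
            ‖iteratedFDeriv ℝ k (fun y => iteratedDeriv l (fun τ => v₀ τ y) t) x‖
          = ν ^ (-((k : ℝ) / 2)) * ((ν * (t - s)) ^ ((k : ℝ) / 2) * (t - s) ^ l *
              ‖iteratedFDeriv ℝ k (fun y => iteratedDeriv l (fun τ => v₀ τ y) t) x‖) := by
            rw [e1]; ring
        _ ≤ ν ^ (-((k : ℝ) / 2)) * C :=
            mul_le_mul_of_nonneg_left hb (Real.rpow_nonneg hν.le _)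
        _ = C₁ := by rw [hC₁]
        _ ≤ C₁ + C₂ := le_add_of_nonneg_right hC₂0
    · -- a restarted window of length `h` at `s' = t - h/2`
      rw [not_lt] at hcase
      set s' : ℝ := t - h / 2 with hs'
      have hss' : s < s' := by rw [hs']; linarith
      have hs'T : s' < T₁ := by rw [hs']; linarith [ht.2]
      obtain ⟨v, -, hwv, hbd⟩ := hwin1 hss' hs'T
      have htw : t ∈ Ioo s' (min (s' + h) T₁) :=
        ⟨by rw [hs']; linarith, lt_min (by rw [hs']; linarith) ht.2⟩
      rw [iteratedFDeriv_iteratedDeriv_congr isOpen_Ioo htw hwv k l x]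
      have hb := hbd t ⟨htw.1, by rw [hs']; linarith⟩ x
      have hts' : t - s' = h / 2 := by rw [hs']; ring
      rw [hts'] at hb
      set D : ℝ := ‖iteratedFDeriv ℝ k (fun y => iteratedDeriv l (fun τ => v τ y) t) x‖ with hD
      have hD0 : 0 ≤ D := norm_nonneg _
      have hDle : D ≤ C / P := by
        rw [le_div_iff₀ hP0]
        calc D * P = P * D := mul_comm _ _
          _ ≤ C := by rw [hP]; exact hb
      have hpow : (t - s) ^ ((k : ℝ) / 2 + l) ≤ (T₁ - s) ^ ((k : ℝ) / 2 + l) :=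
        Real.rpow_le_rpow hτ.le (by linarith [ht.2]) (by positivity)
      calc (t - s) ^ ((k : ℝ) / 2 + l) * D ≤ (T₁ - s) ^ ((k : ℝ) / 2 + l) * (C / P) :=
            mul_le_mul hpow hDle hD0 (Real.rpow_nonneg (by linarith [ht.2]) _)
        _ = C₂ := by rw [hC₂]
        _ ≤ C₁ + C₂ := le_add_of_nonneg_left hC₁0

end Assembly

end Literature.Analysis.FluidPDE

end
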